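import Literature.Topology.FourManifolds.LeeRasmussen
import HarnessLib

/-!
# Rasmussen's `s` under the bookkeeping moves; filtered transport (proofs)

Sibling proof file of `Literature.Topology.FourManifolds.LeeRasmussen` (trunk T-4MAN /
FourManL), working towards the named fact `GaussDiagram.rasmussenInvariant_eq_of_equiv`
(invariance of Rasmussen's `s` under Polyak's Reidemeister moves between realisable Gauss
diagrams). Everything here is proved, for *all* Gauss diagrams (no realisability needed):

* `leeSMax_le_of_filtered` — the algebraic core of every invariance argument for `s`
  (Rasmussen (2010), §2.2: *"if `f : C → C'` is a filtered chain map of degree `k`, then the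
  induced map `f_* : H_*(C) → H_*(C')` is also filtered of degree `k`"*): a map of degree-zero
  Lee cycles that kills no nonzero homology class and does not decrease the filtration degree
  `qMin` gives `s_max(G) ≤ s_max(G')`;
* `rasmussenInvariant_eq_of_transport` — transport along a **signed equivalence of enhanced
  states** `Φ : G.EnhancedState ≃ G'.EnhancedState` preserving both degrees, with signs `ε s`
  (`ε s * ε s = 1`) such that `⟨d (Φ s), Φ s'⟩ = ε s ε s' ⟨d s, s'⟩`: the signed permutation
  of the bases conjugates the Khovanov differentials (`khovanovD_comp_transportMap`), so
  `s_max` and `s` agree;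
* `Transfer G G'` — the combinatorial data inducing such a `Φ` (a bijection of chords keeping
  signs and a bijection of arcs carrying the reconnection relation of every state and the two
  local strands at every chord), with `Transfer.rasmussenInvariant_eq`: `s(G') = s(G)` as soon
  as the change of Koszul signs is the coboundary of a potential `ε` on states;
* `rasmussenInvariant_rotate` — change of base point (`GaussDiagram.rotate`; `ε = 1`);
* `rasmussenInvariant_relabel` — renumbering of the chords (`GaussDiagram.relabel`): adjacent
  transpositions generate the symmetric group and each changes the Koszul signs by the
  coboundary of `koszulSwap` (Khovanov (2000), §3.3, independence of the ordering);
* `rasmussenInvariant_eq_of_isRelabelling` — hence `s` is invariant under the bookkeeping move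
  `PolyakMove.relabel` (`GaussDiagram.IsRelabelling`), the first constructor case of
  `GaussDiagram.Equiv` in `rasmussenInvariant_eq_of_equiv`.

The remaining constructors (`Ω1a`, `Ω1b`, `Ω2a`, `Ω3a`) change the complex by a filtered chain
homotopy equivalence rather than an isomorphism (Rasmussen (2010), §6) and, in the statement of
`rasmussenInvariant_eq_of_equiv`, chains of moves may pass through non-realisable diagrams, for
which Goussarov–Polyak–Viro (2000), Thm. 1.B is needed; those parts are not in this file.

## Sources

* J. Rasmussen, *Khovanov homology and the slice genus*, Invent. Math. 182 (2010) 419–447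
  (arXiv:math/0402131), §2.2 (filtered maps and the induced filtration `S_i` on homology),
  Def. 3.1 (`s_max`), Def. 3.4, Thm. 1, §6.
* M. Khovanov, *A categorification of the Jones polynomial*, Duke Math. J. 101 (2000)
  359–426, §3.3 (independence of the ordering of crossings: sign-twisted isomorphism of cubes).
* O. Viro, *Khovanov homology, its definitions and ramifications*, Fund. Math. 184 (2004),
  §2, §5 (enhanced states of a Gauss diagram; the resolution does not depend on the base point).
* M. Goussarov, M. Polyak, O. Viro, *Finite-type invariants of classical and virtual knots*,
  Topology 39 (2000), §1.2 (based and unbased Gauss diagrams), Thm. 1.B.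
* Mathlib: `Matrix.toLin'_apply`, `Matrix.mulVec_apply_eq_sum`, `Equiv.sum_comp`,
  `Equiv.prod_comp`, `Equiv.subtypeEquiv`, `Submodule.Quotient.mk_eq_zero`, `iSup₂_le`,
  `le_iSup₂_of_le`, `SimpleGraph.Iso.connectedComponentEquiv`, `Finset.card_equiv`,
  `finRotate`, `Equiv.swap`, `Equiv.Perm.mclosure_swap_castSucc_succ`,
  `Submonoid.closure_induction`.
-/

open Function Set

noncomputable section

namespace Literature.Topology.FourManifolds

namespace GaussDiagram

variable {G G' : GaussDiagram}

/-! ## Filtered maps are monotone for `s_max` -/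

/-- **Filtered maps do not decrease `s_max`.** If `φ` sends degree-zero Lee cycles of `G` to
degree-zero Lee cycles of `G'`, kills no nonzero homology class (the induced map on
`Kh'⁰ = ker d₀ ⧸ im d₋₁` is injective on classes) and does not decrease the filtration degree
`qMin`, then `s_max(G) ≤ s_max(G')`: the class of `φ z` is a nonzero class of filtration degree
at least `qMin z`. Rasmussen (2010), §2.2 (a filtered chain map induces a filtered map on
homology), Def. 3.1. [cite: Rasmussen2010, §2.2] -/
theorem leeSMax_le_of_filtered (φ : G.leeCycles → G'.leeCycles)
    (hinj : ∀ z : G.leeCycles, (Submodule.Quotient.mk (φ z) : G'.LeeHomologyZero) = 0 →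
      (Submodule.Quotient.mk z : G.LeeHomologyZero) = 0)
    (hfilt : ∀ z : G.leeCycles, qMin z.1 ≤ qMin (φ z).1) :
    G.leeSMax ≤ G'.leeSMax := by
  refine iSup₂_le fun α hα ↦ iSup₂_le fun z hz ↦ ?_
  have hz : Submodule.Quotient.mk z = α := hz
  have hne : (Submodule.Quotient.mk (φ z) : G'.LeeHomologyZero) ≠ 0 := fun h0 ↦
    hα (hz ▸ hinj z h0)
  exact (hfilt z).trans
    (le_iSup₂_of_le (Submodule.Quotient.mk (φ z)) hne (le_iSup₂_of_le (φ z) rfl le_rfl))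

/-! ## Transport along a signed equivalence of enhanced states -/

section Transport

variable (Φ : G.EnhancedState ≃ G'.EnhancedState) (hdeg : ∀ s, homDegree (Φ s) = homDegree s)

/-- An equivalence of enhanced states preserving the homological degree restricts to
equivalences `degStates i ≃ degStates i` of the bases of the cochain groups.
Khovanov (2000), §3.3. [cite: Khovanov2000, §3.3] -/
def degStatesEquiv (i : ℤ) : G.degStates i ≃ G'.degStates i :=
  Φ.subtypeEquiv fun s ↦ by rw [hdeg]

/-- The underlying enhanced state of a transported basis element. [folklore] -/
@[simp]
theorem degStatesEquiv_apply_val (i : ℤ) (s : G.degStates i) :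
    (degStatesEquiv Φ hdeg i s).1 = Φ s.1 := rfl

/-- The underlying enhanced state of a basis element transported back. [folklore] -/
@[simp]
theorem degStatesEquiv_symm_apply_val (i : ℤ) (t : G'.degStates i) :
    ((degStatesEquiv Φ hdeg i).symm t).1 = Φ.symm t.1 := rfl

variable {R : Type} [CommRing R] (ε : G.EnhancedState → R)

/-- The **signed transport map** on `i`-cochains attached to an equivalence of enhanced states
`Φ` (preserving the homological degree) and signs `ε`: the function `x` on `G.degStates i` is
sent to `t ↦ ε (Φ⁻¹ t) * x (Φ⁻¹ t)` on `G'.degStates i` (a signed permutation of the bases).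
Khovanov (2000), §3.3 (reordering the crossings). [cite: Khovanov2000, §3.3] -/
def transportMap (i : ℤ) : (G.degStates i → R) →ₗ[R] (G'.degStates i → R) where
  toFun x t := ε ((degStatesEquiv Φ hdeg i).symm t).1 * x ((degStatesEquiv Φ hdeg i).symm t)
  map_add' x y := by
    ext t
    simp [mul_add]
  map_smul' c x := by
    ext t
    simp [mul_left_comm]

/-- The value of the signed transport map. [folklore] -/
@[simp]
theorem transportMap_apply (i : ℤ) (x : G.degStates i → R) (t : G'.degStates i) :
    transportMap Φ hdeg ε i x t =
      ε ((degStatesEquiv Φ hdeg i).symm t).1 * x ((degStatesEquiv Φ hdeg i).symm t) := rfl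

/-- **The signed transport map is a chain map**: if the incidence numbers of `G'` between
transported states are those of `G` up to the signs, `⟨d (Φ s), Φ s'⟩ = ε s ε s' ⟨d s, s'⟩`
with `ε s * ε s = 1`, then `d' ∘ P = P ∘ d` in all degrees. Khovanov (2000), §3.3. [cite: Khovanov2000, §3.3] -/
theorem khovanovD_comp_transportMap (h t : R) (hε : ∀ s, ε s * ε s = 1)
    (hinc : ∀ s s', G'.incidence R h t (Φ s) (Φ s') = ε s * ε s' * G.incidence R h t s s')
    (i i' : ℤ) :
    G'.khovanovD R h t i i' ∘ₗ transportMap Φ hdeg ε i =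
      transportMap Φ hdeg ε i' ∘ₗ G.khovanovD R h t i i' := by
  refine LinearMap.ext fun x ↦ funext fun t' ↦ ?_
  simp only [LinearMap.comp_apply, khovanovD, Matrix.toLin'_apply, transportMap_apply,
    Matrix.mulVec_apply_eq_sum, Matrix.of_apply, Finset.mul_sum]
  rw [← Equiv.sum_comp (degStatesEquiv Φ hdeg i)]
  refine Finset.sum_congr rfl fun s _ ↦ ?_
  simp only [Equiv.symm_apply_apply, degStatesEquiv_apply_val]
  set s'' := (degStatesEquiv Φ hdeg i').symm t' with hs''
  have ht' : t'.1 = Φ s''.1 := by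
    rw [hs'', degStatesEquiv_symm_apply_val, Equiv.apply_symm_apply]
  rw [ht', hinc]
  have := hε s.1
  linear_combination (ε s''.1 * G.incidence R h t s.1 s''.1 * x s) * this

/-- Transport twice is the identity: the transport map of `Φ⁻¹` with signs `ε ∘ Φ⁻¹` is a
left inverse of the transport map of `Φ`. Khovanov (2000), §3.3. [cite: Khovanov2000, §3.3] -/
theorem transportMap_symm_transportMap (hε : ∀ s, ε s * ε s = 1) (i : ℤ)
    (x : G.degStates i → R) :
    transportMap Φ.symm (fun t ↦ by simpa using (hdeg (Φ.symm t)).symm) (ε ∘ Φ.symm) i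
      (transportMap Φ hdeg ε i x) = x := by
  funext s
  simp only [transportMap_apply, comp_apply, degStatesEquiv_symm_apply_val, Equiv.symm_symm]
  have h1 : ((degStatesEquiv Φ hdeg i).symm
      ((degStatesEquiv Φ.symm (fun t ↦ by simpa using (hdeg (Φ.symm t)).symm) i).symm s)) = s := by
    apply Subtype.ext
    simp
  rw [h1, Equiv.symm_apply_apply, ← mul_assoc, hε, one_mul]

include hdeg in
/-- The hypotheses of the transport are symmetric: `Φ⁻¹` preserves the homological degree.
[folklore] -/
theorem homDegree_transport_symm (t : G'.EnhancedState) : homDegree (Φ.symm t) = homDegree t := by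
  simpa using (hdeg (Φ.symm t)).symm

/-- The hypotheses of the transport are symmetric: the incidence numbers of `G` between the
preimages are those of `G'` up to the signs `ε ∘ Φ⁻¹`. [folklore] -/
theorem incidence_transport_symm (h t : R) (hε : ∀ s, ε s * ε s = 1)
    (hinc : ∀ s s', G'.incidence R h t (Φ s) (Φ s') = ε s * ε s' * G.incidence R h t s s')
    (u u' : G'.EnhancedState) :
    G.incidence R h t (Φ.symm u) (Φ.symm u') =
      (ε ∘ Φ.symm) u * (ε ∘ Φ.symm) u' * G'.incidence R h t u u' := by
  have H := hinc (Φ.symm u) (Φ.symm u')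
  simp only [Equiv.apply_symm_apply] at H
  have h1 := hε (Φ.symm u)
  have h2 := hε (Φ.symm u')
  rw [H, comp_apply, comp_apply]
  linear_combination (-(G.incidence R h t (Φ.symm u) (Φ.symm u')) * (ε (Φ.symm u') *
    ε (Φ.symm u'))) * h1 - G.incidence R h t (Φ.symm u) (Φ.symm u') * h2

end Transport

/-! ## Transport of the filtration and of `s` (Lee theory, `(R, h, t) = (ℚ, 0, 1)`) -/

section LeeTransport

variable (Φ : G.EnhancedState ≃ G'.EnhancedState) (hdeg : ∀ s, homDegree (Φ s) = homDegree s)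
  (ε : G.EnhancedState → ℚ)

include hdeg

/-- A signed transport along an equivalence of enhanced states preserving the quantum degree
preserves the filtration degree `qMin` of degree-zero chains (the support is carried by `Φ`,
signs do not matter). Rasmussen (2010), §2.1. [cite: Rasmussen2010, §2.1] -/
theorem qMin_transportMap (hq : ∀ s, qDegree (Φ s) = qDegree s) (hε : ∀ s, ε s * ε s = 1)
    (x : G.degStates 0 → ℚ) : qMin (transportMap Φ hdeg ε 0 x) = qMin x := by
  unfold qMin
  rw [← (degStatesEquiv Φ hdeg 0).iInf_comp]
  refine iInf_congr fun s ↦ ?_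
  have h1 : (degStatesEquiv Φ hdeg 0).symm (degStatesEquiv Φ hdeg 0 s) = s :=
    Equiv.symm_apply_apply _ _
  have hεs : ε s.1 ≠ 0 := left_ne_zero_of_mul_eq_one (hε s.1)
  simp only [Set.mem_setOf_eq, transportMap_apply, h1, degStatesEquiv_apply_val, hq, ne_eq,
    mul_eq_zero, hεs, false_or]

/-- **`s_max` does not decrease along a signed transport.** If `Φ` is an equivalence of enhanced
states preserving both degrees and the Lee incidence numbers up to signs `ε s ε s'`
(`ε s * ε s = 1`), then `s_max(G) ≤ s_max(G')`: the transport map is a filtered chain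
isomorphism (`khovanovD_comp_transportMap`, `transportMap_symm_transportMap`,
`qMin_transportMap`), so `leeSMax_le_of_filtered` applies. Rasmussen (2010), §2.2;
Khovanov (2000), §3.3. [cite: Rasmussen2010, §2.2] -/
theorem leeSMax_le_of_transport (hq : ∀ s, qDegree (Φ s) = qDegree s)
    (hε : ∀ s, ε s * ε s = 1)
    (hinc : ∀ s s', G'.incidence ℚ 0 1 (Φ s) (Φ s') = ε s * ε s' * G.incidence ℚ 0 1 s s') :
    G.leeSMax ≤ G'.leeSMax := by
  have hcomm := khovanovD_comp_transportMap Φ hdeg ε (0 : ℚ) 1 hε hinc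
  -- the transport map sends cycles to cycles
  let φ : G.leeCycles → G'.leeCycles := fun z ↦ ⟨transportMap Φ hdeg ε 0 z.1, by
    have hz := z.2
    rw [LinearMap.mem_ker] at hz ⊢
    have H := congrArg (fun f ↦ f z.1) (hcomm 0 (0 + 1))
    simp only [LinearMap.comp_apply] at H
    rw [H, hz, map_zero]⟩
  refine leeSMax_le_of_filtered φ (fun z h0 ↦ ?_)
    (fun z ↦ (qMin_transportMap Φ hdeg ε hq hε z.1).ge)
  -- and kills no nonzero class: its inverse transport sends boundaries to boundaries
  rw [Submodule.Quotient.mk_eq_zero, Submodule.mem_comap, LinearMap.mem_range] at h0 ⊢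
  obtain ⟨y', hy'⟩ := h0
  have hdeg' := homDegree_transport_symm Φ hdeg
  have hε' : ∀ u, (ε ∘ Φ.symm) u * (ε ∘ Φ.symm) u = 1 := fun u ↦ hε _
  have hinc' := incidence_transport_symm Φ ε (0 : ℚ) 1 hε hinc
  have hcomm' := khovanovD_comp_transportMap Φ.symm hdeg' (ε ∘ Φ.symm) (0 : ℚ) 1 hε' hinc'
    (0 - 1) 0
  refine ⟨transportMap Φ.symm hdeg' (ε ∘ Φ.symm) (0 - 1) y', ?_⟩
  have H := congrArg (fun f ↦ f y') hcomm'
  simp only [LinearMap.comp_apply] at H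
  rw [H, hy']
  exact transportMap_symm_transportMap Φ hdeg ε hε 0 z.1

/-- **`s_max` is invariant under signed transport** along an equivalence of enhanced states
preserving both degrees and the Lee incidence numbers up to signs. Rasmussen (2010), §2.2,
Def. 3.1; Khovanov (2000), §3.3. [cite: Rasmussen2010, §2.2] -/
theorem leeSMax_eq_of_transport (hq : ∀ s, qDegree (Φ s) = qDegree s)
    (hε : ∀ s, ε s * ε s = 1)
    (hinc : ∀ s s', G'.incidence ℚ 0 1 (Φ s) (Φ s') = ε s * ε s' * G.incidence ℚ 0 1 s s') :
    G'.leeSMax = G.leeSMax := by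
  refine le_antisymm ?_ (leeSMax_le_of_transport Φ hdeg ε hq hε hinc)
  have hq' : ∀ u, qDegree (Φ.symm u) = qDegree u := fun u ↦ by simpa using (hq (Φ.symm u)).symm
  exact leeSMax_le_of_transport Φ.symm (homDegree_transport_symm Φ hdeg) (ε ∘ Φ.symm) hq'
    (fun u ↦ hε _) (incidence_transport_symm Φ ε (0 : ℚ) 1 hε hinc)

/-- **Rasmussen's `s` is invariant under signed transport** along an equivalence of enhanced
states preserving both degrees and the Lee incidence numbers up to signs `ε s ε s'` with
`ε s * ε s = 1` (`s = s_max - 1`, `leeSMax_eq_of_transport`). This is the algebraic form of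
the invariance of `s` under the bookkeeping moves (change of base point, renumbering of the
chords). Rasmussen (2010), §2.2, Def. 3.4; Khovanov (2000), §3.3. [cite: Rasmussen2010, §2.2] -/
theorem rasmussenInvariant_eq_of_transport (hq : ∀ s, qDegree (Φ s) = qDegree s)
    (hε : ∀ s, ε s * ε s = 1)
    (hinc : ∀ s s', G'.incidence ℚ 0 1 (Φ s) (Φ s') = ε s * ε s' * G.incidence ℚ 0 1 s s') :
    G'.rasmussenInvariant = G.rasmussenInvariant := by
  rw [rasmussenInvariant, rasmussenInvariant, leeSMax_eq_of_transport Φ hdeg ε hq hε hinc]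

end LeeTransport

/-! ## Combinatorial transfer data between Gauss diagrams

The bookkeeping moves act on a Gauss diagram through a bijection of chords and a bijection of
arcs compatible with signs, with the reconnection relation of every state and with the two
local strands at every chord. We package these data (`Transfer`) and derive from them the
signed equivalence of enhanced states fed to `rasmussenInvariant_eq_of_transport`. -/

/-- Evaluation of the incidence number `⟨d s, s'⟩` when `s'` is obtained from `s` by flipping
the `0`-smoothing at the chord `i` (the chord extracted by `Classical.choose` in `incidence` is
then `i`). Viro (2004), §5.2. [cite: Viro2004, §5.2] -/
theorem incidence_of_update {R : Type} [CommRing R] (h t : R) {s s' : G.EnhancedState}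
    {i : Fin G.n} (hi : s.state i = false) (hs' : s'.state = Function.update s.state i true) :
    G.incidence R h t s s' =
      if G.IsMergeAt s.state i then
        (if ∀ c, G.circleOf s'.state c ≠ G.circleOf s'.state (G.arcIn (G.overPos i)) →
            s'.label c = s.label c then
          (edgeSign s.state i : R) * mergeCoeff R h t (s.label (G.arcIn (G.overPos i)))
            (s.label (G.arcOut (G.overPos i))) (s'.label (G.arcIn (G.overPos i)))
        else 0)
      else if G.IsSplitAt s.state i then
        (if ∀ c, G.circleOf s.state c ≠ G.circleOf s.state (G.arcIn (G.overPos i)) →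
            s'.label c = s.label c then
          (edgeSign s.state i : R) * splitCoeff R h t (s.label (G.arcIn (G.overPos i)))
            (s'.label (G.arcIn (G.overPos i))) (s'.label (G.arcOut (G.overPos i)))
        else 0)
      else 0 := by
  have hex : ∃ j, s.state j = false ∧ s'.state = Function.update s.state j true := ⟨i, hi, hs'⟩
  have hj : Classical.choose hex = i := by
    obtain ⟨hj0, hj⟩ := Classical.choose_spec hex
    by_contra hne
    have h1 := congrFun hj (Classical.choose hex)
    have h2 := congrFun hs' (Classical.choose hex)
    rw [Function.update_self] at h1
    rw [Function.update_of_ne hne, hj0] at h2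
    exact Bool.noConfusion (h1.symm.trans h2)
  unfold incidence
  rw [dif_pos hex]
  simp only [hj]

/-- The incidence number `⟨d s, s'⟩` vanishes unless `s'` is obtained from `s` by flipping a
single `0`-smoothing. Viro (2004), §5.2. [cite: Viro2004, §5.2] -/
theorem incidence_eq_zero_of_not_exists {R : Type} [CommRing R] (h t : R) {s s' : G.EnhancedState}
    (hn : ¬ ∃ i, s.state i = false ∧ s'.state = Function.update s.state i true) :
    G.incidence R h t s s' = 0 := by
  unfold incidence
  rw [dif_neg hn]

variable (G G') in
/-- **Transfer data** between two Gauss diagrams: a bijection of chords preserving signs and a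
bijection of arcs which, for every state (transported along the chord bijection), carries the
reconnection relation of `G` onto that of `G'` and the two local strands
`arcIn (overPos i)`, `arcOut (overPos i)` at every chord onto those at the corresponding chord.
Rotation of the base point and renumbering of the chords (`PolyakMove.relabel`) give such data.
[folklore] -/
structure Transfer where
  /-- The bijection of chords. -/
  chord : Fin G.n ≃ Fin G'.n
  /-- The bijection of arcs. -/
  arc : G.Arc ≃ G'.Arc
  /-- Corresponding chords have the same sign. -/
  sign_chord : ∀ i, G'.sign (chord i) = G.sign i
  /-- The arc bijection carries the reconnection relation of every state to that of the
  transported state. -/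
  stateAdj_iff : ∀ (σ : G.State) (a b : G.Arc),
    G'.stateAdj (σ ∘ chord.symm) (arc a) (arc b) ↔ G.stateAdj σ a b
  /-- The arc bijection carries the incoming local strand at every chord to the incoming local
  strand at the corresponding chord. -/
  arcIn_overPos : ∀ i, G'.arcIn (G'.overPos (chord i)) = arc (G.arcIn (G.overPos i))
  /-- The arc bijection carries the outgoing local strand at every chord to the outgoing local
  strand at the corresponding chord. -/
  arcOut_overPos : ∀ i, G'.arcOut (G'.overPos (chord i)) = arc (G.arcOut (G.overPos i))

namespace Transfer

variable (T : Transfer G G')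

/-- The transported state: chord `T.chord i` of `G'` is smoothed as chord `i` of `G`. [folklore] -/
def stateMap (σ : G.State) : G'.State := σ ∘ T.chord.symm

/-- The value of the transported state. [folklore] -/
@[simp]
theorem stateMap_apply (σ : G.State) (j : Fin G'.n) : T.stateMap σ j = σ (T.chord.symm j) := rfl

/-- The transported state at the corresponding chord. [folklore] -/
theorem stateMap_apply_chord (σ : G.State) (i : Fin G.n) : T.stateMap σ (T.chord i) = σ i := by
  simp [stateMap]

/-- Transport of states is a bijection. [folklore] -/
def stateEquiv : G.State ≃ G'.State where
  toFun := T.stateMap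
  invFun σ' := σ' ∘ T.chord
  left_inv σ := by ext i; simp [stateMap]
  right_inv σ' := by ext j; simp [stateMap]

/-- Transport of states commutes with flipping a smoothing. [folklore] -/
theorem stateMap_update (σ : G.State) (i : Fin G.n) (b : Bool) :
    T.stateMap (Function.update σ i b) = Function.update (T.stateMap σ) (T.chord i) b := by
  ext j
  by_cases hj : j = T.chord i
  · subst hj; simp [stateMap]
  · have : T.chord.symm j ≠ i := fun h ↦ hj (by rw [← h, Equiv.apply_symm_apply])
    simp [stateMap, Function.update_of_ne hj, Function.update_of_ne this]

/-- Transport of states preserves the weight. Bar-Natan (2002), §3.1. [cite: BarNatan2002, §3.1] -/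
theorem weight_stateMap (σ : G.State) : (T.stateMap σ).weight = σ.weight := by
  unfold State.weight
  refine Finset.card_equiv T.chord.symm fun j ↦ ?_
  simp [stateMap]

include T in
/-- Transfer data preserve the number of positive crossings. [folklore] -/
theorem nPlus_eq : G'.nPlus = G.nPlus := by
  unfold nPlus
  refine Finset.card_equiv T.chord.symm fun j ↦ ?_
  simp only [Finset.mem_filter, Finset.mem_univ, true_and]
  rw [← T.sign_chord, Equiv.apply_symm_apply]

include T in
/-- Transfer data preserve the number of negative crossings. [folklore] -/
theorem nMinus_eq : G'.nMinus = G.nMinus := by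
  unfold nMinus
  refine Finset.card_equiv T.chord.symm fun j ↦ ?_
  simp only [Finset.mem_filter, Finset.mem_univ, true_and]
  rw [← T.sign_chord, Equiv.apply_symm_apply]

/-- The Seifert rule is transported. [folklore] -/
theorem isSeifert_stateMap (σ : G.State) (i : Fin G.n) :
    G'.isSeifert (T.stateMap σ) (T.chord i) = G.isSeifert σ i := by
  simp [isSeifert, stateMap, T.sign_chord]

/-- The arc bijection carries the reconnection relation of `σ` to that of the transported
state (restatement of `stateAdj_iff`). [folklore] -/
theorem stateAdj_stateMap_iff (σ : G.State) (a b : G.Arc) :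
    G'.stateAdj (T.stateMap σ) (T.arc a) (T.arc b) ↔ G.stateAdj σ a b :=
  T.stateAdj_iff σ a b

/-- The arc bijection is an isomorphism of state graphs. [folklore] -/
def graphIso (σ : G.State) : G.stateGraph σ ≃g G'.stateGraph (T.stateMap σ) where
  toEquiv := T.arc
  map_rel_iff' := by
    intro a b
    simp only [stateGraph, SimpleGraph.fromRel_adj, T.arc.injective.ne_iff]
    rw [T.stateAdj_stateMap_iff σ a b, T.stateAdj_stateMap_iff σ b a]

/-- The isomorphism of state graphs is the arc bijection. [folklore] -/
@[simp]
theorem graphIso_apply (σ : G.State) (a : G.Arc) : T.graphIso σ a = T.arc a := rfl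

/-- The induced bijection of state circles. [folklore] -/
def circleEquiv (σ : G.State) : G.StateCircle σ ≃ G'.StateCircle (T.stateMap σ) :=
  (T.graphIso σ).connectedComponentEquiv

/-- The bijection of state circles sends the circle of an arc to the circle of its image.
[folklore] -/
@[simp]
theorem circleEquiv_circleOf (σ : G.State) (a : G.Arc) :
    T.circleEquiv σ (G.circleOf σ a) = G'.circleOf (T.stateMap σ) (T.arc a) := rfl

/-- Two arcs lie on the same state circle iff their images do. [folklore] -/
theorem circleOf_arc_eq_iff (σ : G.State) (a b : G.Arc) :
    G'.circleOf (T.stateMap σ) (T.arc a) = G'.circleOf (T.stateMap σ) (T.arc b) ↔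
      G.circleOf σ a = G.circleOf σ b := by
  rw [← circleEquiv_circleOf, ← circleEquiv_circleOf, (T.circleEquiv σ).injective.eq_iff]

/-- Transporting a state of `G'` back and forth is the identity. [folklore] -/
@[simp]
theorem stateMap_comp_chord (σ' : G'.State) : T.stateMap (σ' ∘ T.chord) = σ' := by
  ext j; simp [stateMap]

/-- The transported enhanced state: transported state, labels carried along the arc
bijection. Khovanov (2000), §3.3; Viro (2004), §5.1. [cite: Viro2004, §5.1] -/
def enhancedMap (s : G.EnhancedState) : G'.EnhancedState where
  state := T.stateMap s.state
  label := s.label ∘ T.arc.symm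
  label_eq _ _ hab := s.label_eq _ _ ((T.graphIso s.state).symm.map_rel_iff.2 hab)

/-- The inverse transport of enhanced states. [folklore] -/
def enhancedInv (u : G'.EnhancedState) : G.EnhancedState where
  state := u.state ∘ T.chord
  label := u.label ∘ T.arc
  label_eq a b hab := by
    apply u.label_eq
    have := (T.graphIso (u.state ∘ T.chord)).map_rel_iff.2 hab
    simpa using this

/-- The state of the transported enhanced state. [folklore] -/
@[simp] theorem enhancedMap_state (s : G.EnhancedState) :
    (T.enhancedMap s).state = T.stateMap s.state := rfl

/-- The labels of the transported enhanced state. [folklore] -/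
@[simp] theorem enhancedMap_label (s : G.EnhancedState) :
    (T.enhancedMap s).label = s.label ∘ T.arc.symm := rfl

/-- The state of the back-transported enhanced state. [folklore] -/
@[simp] theorem enhancedInv_state (u : G'.EnhancedState) :
    (T.enhancedInv u).state = u.state ∘ T.chord := rfl

/-- The labels of the back-transported enhanced state. [folklore] -/
@[simp] theorem enhancedInv_label (u : G'.EnhancedState) :
    (T.enhancedInv u).label = u.label ∘ T.arc := rfl

omit T in
/-- Two enhanced states with the same state and the same labels are equal. [folklore] -/
theorem _root_.Literature.Topology.FourManifolds.GaussDiagram.EnhancedState.ext'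
    {s₁ s₂ : G.EnhancedState} (h₁ : s₁.state = s₂.state) (h₂ : s₁.label = s₂.label) : s₁ = s₂ := by
  cases s₁; cases s₂; cases h₁; cases h₂; rfl

/-- **Transfer data induce a bijection of enhanced states.** Khovanov (2000), §3.3. [cite: Khovanov2000, §3.3] -/
def enhancedEquiv : G.EnhancedState ≃ G'.EnhancedState where
  toFun := T.enhancedMap
  invFun := T.enhancedInv
  left_inv s := EnhancedState.ext' (by ext i; simp [stateMap]) (by ext a; simp)
  right_inv u := EnhancedState.ext' (by ext j; simp [stateMap]) (by ext a; simp)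

/-- The bijection of enhanced states is `enhancedMap`. [folklore] -/
@[simp] theorem enhancedEquiv_apply (s : G.EnhancedState) : T.enhancedEquiv s = T.enhancedMap s :=
  rfl

/-- The bijection of enhanced states preserves the homological degree. Bar-Natan (2002),
§3.2. [cite: BarNatan2002, §3.2] -/
theorem homDegree_enhancedMap (s : G.EnhancedState) :
    homDegree (T.enhancedMap s) = homDegree s := by
  simp [homDegree, weight_stateMap, T.nMinus_eq]

/-- The bijection of state circles matches the circles carrying a given label. [folklore] -/
theorem card_filter_label_eq (s : G.EnhancedState) (b : Bool) :
    (Finset.univ.filter fun c' : G'.StateCircle (T.enhancedMap s).state ↦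
        ∃ a', G'.circleOf (T.enhancedMap s).state a' = c' ∧ (T.enhancedMap s).label a' = b).card =
      (Finset.univ.filter fun c : G.StateCircle s.state ↦
        ∃ a, G.circleOf s.state a = c ∧ s.label a = b).card := by
  symm
  refine Finset.card_equiv (T.circleEquiv s.state) fun c ↦ ?_
  simp only [Finset.mem_filter, Finset.mem_univ, true_and]
  constructor
  · rintro ⟨a, rfl, hb⟩
    exact ⟨T.arc a, rfl, by simpa using hb⟩
  · rintro ⟨a', ha', hb⟩
    refine ⟨T.arc.symm a', (T.circleEquiv s.state).injective ?_, by simpa using hb⟩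
    rw [circleEquiv_circleOf, Equiv.apply_symm_apply]
    exact ha'

/-- The bijection of enhanced states preserves the quantum degree. Bar-Natan (2002), §3.2. [cite: BarNatan2002, §3.2] -/
theorem qDegree_enhancedMap (s : G.EnhancedState) :
    qDegree (T.enhancedMap s) = qDegree s := by
  unfold qDegree
  rw [T.card_filter_label_eq s false, T.card_filter_label_eq s true, enhancedMap_state,
    weight_stateMap, T.nPlus_eq, T.nMinus_eq]

/-- Merges are transported to merges. Viro (2004), §5.2. [cite: Viro2004, §5.2] -/
theorem isMergeAt_iff (σ : G.State) (i : Fin G.n) :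
    G'.IsMergeAt (T.stateMap σ) (T.chord i) ↔ G.IsMergeAt σ i := by
  simp only [IsMergeAt, stateMap_apply_chord, T.arcIn_overPos, T.arcOut_overPos, ne_eq,
    T.circleOf_arc_eq_iff]

/-- Splits are transported to splits. Viro (2004), §5.2. [cite: Viro2004, §5.2] -/
theorem isSplitAt_iff (σ : G.State) (i : Fin G.n) :
    G'.IsSplitAt (T.stateMap σ) (T.chord i) ↔ G.IsSplitAt σ i := by
  unfold IsSplitAt
  rw [stateMap_apply_chord, ← T.stateMap_update, T.arcIn_overPos, T.arcOut_overPos, ne_eq, ne_eq,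
    T.circleOf_arc_eq_iff]

/-- The square of a Koszul sign is `1`. [folklore] -/
theorem edgeSign_mul_self {R : Type} [CommRing R] (σ : G.State) (i : Fin G.n) :
    (edgeSign σ i : R) * edgeSign σ i = 1 := by
  rw [← Int.cast_mul, edgeSign, ← pow_add, ← two_mul, pow_mul]
  simp

/-- **Incidence numbers are transported up to the Koszul signs**: if `s'` is obtained from `s`
by flipping the `0`-smoothing at chord `i`, then
`⟨d (Φ s), Φ s'⟩ = sgn'(Φ s, i') · sgn(s, i) · ⟨d s, s'⟩` where `i'` is the corresponding chord,
i.e. the merge/split coefficient is literally the same and only the Koszul sign may change.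
Viro (2004), §5.2; Khovanov (2000), §3.3. [cite: Khovanov2000, §3.3] -/
theorem incidence_enhancedMap {R : Type} [CommRing R] (h t : R) {s s' : G.EnhancedState}
    {i : Fin G.n} (hi : s.state i = false) (hs' : s'.state = Function.update s.state i true) :
    G'.incidence R h t (T.enhancedMap s) (T.enhancedMap s') =
      (edgeSign (T.stateMap s.state) (T.chord i) : R) * edgeSign s.state i *
        G.incidence R h t s s' := by
  have hi' : (T.enhancedMap s).state (T.chord i) = false := by simpa using hi
  have hs'' : (T.enhancedMap s').state =
      Function.update (T.enhancedMap s).state (T.chord i) true := by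
    simp [hs', stateMap_update]
  rw [incidence_of_update h t hi' hs'', incidence_of_update h t hi hs']
  have hM := T.isMergeAt_iff s.state i
  have hS := T.isSplitAt_iff s.state i
  simp only [enhancedMap_state] at hM hS ⊢
  have hsq := edgeSign_mul_self (R := R) s.state i
  -- the local strands and their labels
  have hlab : ∀ (u : G.EnhancedState),
      (T.enhancedMap u).label (G'.arcIn (G'.overPos (T.chord i))) = u.label (G.arcIn (G.overPos i))
      ∧ (T.enhancedMap u).label (G'.arcOut (G'.overPos (T.chord i))) =
        u.label (G.arcOut (G.overPos i)) := fun u ↦ by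
    simp [T.arcIn_overPos, T.arcOut_overPos]
  -- the label conditions
  have hcond : ∀ (σ : G.State),
      (∀ c', G'.circleOf (T.stateMap σ) c' ≠
          G'.circleOf (T.stateMap σ) (G'.arcIn (G'.overPos (T.chord i))) →
        (T.enhancedMap s').label c' = (T.enhancedMap s).label c') ↔
      (∀ c, G.circleOf σ c ≠ G.circleOf σ (G.arcIn (G.overPos i)) → s'.label c = s.label c) :=
    fun σ ↦ by
      rw [T.arc.surjective.forall]
      refine forall_congr' fun c ↦ ?_
      simp [T.arcIn_overPos, T.circleOf_arc_eq_iff]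
  obtain ⟨ha, hb⟩ := hlab s
  obtain ⟨ha', hb'⟩ := hlab s'
  by_cases h1 : G.IsMergeAt s.state i
  · rw [if_pos h1, if_pos (hM.2 h1)]
    by_cases h2 : ∀ c, G.circleOf s'.state c ≠ G.circleOf s'.state (G.arcIn (G.overPos i)) →
        s'.label c = s.label c
    · rw [if_pos h2, if_pos ((hcond s'.state).2 h2), ha, hb, ha']
      linear_combination (-(↑(edgeSign (T.stateMap s.state) (T.chord i)) *
        mergeCoeff R h t (s.label (G.arcIn (G.overPos i))) (s.label (G.arcOut (G.overPos i)))
          (s'.label (G.arcIn (G.overPos i))))) * hsq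
    · rw [if_neg h2, if_neg (mt (hcond s'.state).1 h2), mul_zero]
  · rw [if_neg h1, if_neg (mt hM.1 h1)]
    by_cases h3 : G.IsSplitAt s.state i
    · rw [if_pos h3, if_pos (hS.2 h3)]
      by_cases h4 : ∀ c, G.circleOf s.state c ≠ G.circleOf s.state (G.arcIn (G.overPos i)) →
          s'.label c = s.label c
      · rw [if_pos h4, if_pos ((hcond s.state).2 h4), ha, ha', hb']
        linear_combination (-(↑(edgeSign (T.stateMap s.state) (T.chord i)) *
          splitCoeff R h t (s.label (G.arcIn (G.overPos i))) (s'.label (G.arcIn (G.overPos i)))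
            (s'.label (G.arcOut (G.overPos i))))) * hsq
      · rw [if_neg h4, if_neg (mt (hcond s.state).1 h4), mul_zero]
    · rw [if_neg h3, if_neg (mt hS.1 h3), mul_zero]

/-- **Transfer data with a Koszul potential preserve Rasmussen's `s`.** If the change of the
Koszul signs along the chord bijection is a coboundary — there are signs `ε σ` (`ε σ * ε σ = 1`)
on states with `sgn'(σ', i') = ε σ · ε (σ[i ↦ 1]) · sgn(σ, i)` at every `0`-smoothed chord —
then the signed transport `s ↦ ε (s.state) · Φ s` is a filtered isomorphism of Lee complexes and
`s(G') = s(G)` (`rasmussenInvariant_eq_of_transport`). Khovanov (2000), §3.3 (independence of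
the ordering of crossings); Rasmussen (2010), §2.2. [cite: Khovanov2000, §3.3] -/
theorem rasmussenInvariant_eq (ε : G.State → ℚ) (hε : ∀ σ, ε σ * ε σ = 1)
    (hsign : ∀ (σ : G.State) (i : Fin G.n), σ i = false →
      (edgeSign (T.stateMap σ) (T.chord i) : ℚ) = ε σ * ε (Function.update σ i true) * edgeSign σ i) :
    G'.rasmussenInvariant = G.rasmussenInvariant := by
  refine rasmussenInvariant_eq_of_transport T.enhancedEquiv (fun s ↦ T.homDegree_enhancedMap s)
    (fun s ↦ ε s.state) (fun s ↦ T.qDegree_enhancedMap s) (fun s ↦ hε s.state) (fun s s' ↦ ?_)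
  simp only [enhancedEquiv_apply]
  by_cases hex : ∃ i, s.state i = false ∧ s'.state = Function.update s.state i true
  · obtain ⟨i, hi, hs'⟩ := hex
    rw [T.incidence_enhancedMap (0 : ℚ) 1 hi hs', hsign s.state i hi, ← hs']
    have hsq := edgeSign_mul_self (R := ℚ) s.state i
    linear_combination (ε s.state * ε s'.state * G.incidence ℚ 0 1 s s') * hsq
  · rw [incidence_eq_zero_of_not_exists (0 : ℚ) 1 hex,
      incidence_eq_zero_of_not_exists (0 : ℚ) 1 ?_]
    · ring
    · rintro ⟨j, hj, hj'⟩
      obtain ⟨i, rfl⟩ := T.chord.surjective j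
      refine hex ⟨i, ?_, T.stateEquiv.injective ?_⟩
      · simpa [stateMap] using hj
      · have h2 : T.stateMap s'.state = T.stateMap (Function.update s.state i true) := by
          simpa [← stateMap_update] using hj'
        exact h2

end Transfer

/-! ## Change of base point: `s` of a rotated Gauss diagram -/

section Rotate

/-- The value of an iterated rotation of `Fin m`: `(finRotate m)^k p = p + k (mod m)`. [folklore] -/
theorem val_finRotate_pow_apply (m k : ℕ) (p : Fin m) :
    (((finRotate m) ^ k) p : ℕ) = (p + k) % m := by
  induction k with
  | zero => simp [Nat.mod_eq_of_lt p.isLt]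
  | succ k ih =>
    rw [pow_succ', Equiv.Perm.mul_apply]
    cases m with
    | zero => exact p.elim0
    | succ m =>
      rw [finRotate_apply, Fin.val_add, ih, Fin.val_one', ← Nat.add_mod]
      rfl

variable (G : GaussDiagram) (k : ℕ)

/-- The rotation of the marked points by `k` steps (`finRotate` iterated `k` times), the
permutation of positions underlying `GaussDiagram.rotate`. GPV (2000), §1.2. [cite: GPV2000, §1.2] -/
def rotPos : Equiv.Perm (Fin (2 * G.n)) := (finRotate (2 * G.n)) ^ k

/-- The rotated position of `p` is `p + k (mod 2n)`. [folklore] -/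
theorem val_rotPos (p : Fin (2 * G.n)) : (G.rotPos k p : ℕ) = (p + k) % (2 * G.n) :=
  val_finRotate_pow_apply _ _ _

/-- Rotation keeps the number of chords. [folklore] -/
theorem rotate_n : (G.rotate k).n = G.n := rfl

/-- Rotation moves the over-passages by the rotation of positions. [folklore] -/
theorem rotate_overPos (i : Fin G.n) : (G.rotate k).overPos i = G.rotPos k (G.overPos i) := rfl

/-- Rotation moves the under-passages by the rotation of positions. [folklore] -/
theorem rotate_underPos (i : Fin G.n) : (G.rotate k).underPos i = G.rotPos k (G.underPos i) := rfl

/-- Rotation keeps the signs. [folklore] -/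
theorem rotate_sign : (G.rotate k).sign = G.sign := rfl

/-- The number of arcs is positive (the empty diagram has one arc). [folklore] -/
instance : NeZero G.arcCount := ⟨by unfold arcCount; omega⟩

/-- A diagram with a marked point has `2n` arcs. [folklore] -/
theorem arcCount_eq_of_pos (h : 0 < 2 * G.n) : G.arcCount = 2 * G.n := by
  unfold arcCount; omega

/-- The rotation of arcs by `k` steps: arc `q` becomes arc `q + k (mod 2n)`. [folklore] -/
def rotArc : _root_.Equiv.Perm G.Arc := _root_.Equiv.addRight (Fin.ofNat G.arcCount k)

/-- The rotated arc of `a` is `a + k (mod 2n)`. [folklore] -/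
theorem val_rotArc (a : G.Arc) : (G.rotArc k a : ℕ) = (a + k) % G.arcCount := by
  simp [rotArc, Fin.val_add]

/-- Rotation carries the arc leaving `p` to the arc leaving the rotated point. [folklore] -/
theorem rotArc_arcOut (p : Fin (2 * G.n)) :
    G.rotArc k (G.arcOut p) = (G.rotate k).arcOut (G.rotPos k p) := by
  apply Fin.ext
  rw [val_rotArc]
  show (p.val + k) % G.arcCount = (G.rotPos k p : ℕ)
  rw [val_rotPos, G.arcCount_eq_of_pos (Fin.pos p)]

/-- Rotation carries the arc entering `p` to the arc entering the rotated point. [folklore] -/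
theorem rotArc_arcIn (p : Fin (2 * G.n)) :
    G.rotArc k (G.arcIn p) = (G.rotate k).arcIn (G.rotPos k p) := by
  apply Fin.ext
  rw [val_rotArc]
  show ((p.val + 2 * G.n - 1) % (2 * G.n) + k) % G.arcCount =
    ((G.rotPos k p : ℕ) + 2 * G.n - 1) % (2 * G.n)
  have h2 : 0 < 2 * G.n := Fin.pos p
  rw [val_rotPos, G.arcCount_eq_of_pos h2, Nat.mod_add_mod,
    show (p.val + k) % (2 * G.n) + 2 * G.n - 1 = (p.val + k) % (2 * G.n) + (2 * G.n - 1) by omega,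
    Nat.mod_add_mod]
  congr 1
  omega

/-- Rotation does not change the chord through a (rotated) marked point. [folklore] -/
theorem chordOf_rotate (p : Fin (2 * G.n)) : (G.rotate k).chordOf (G.rotPos k p) = G.chordOf p := by
  obtain ⟨i, rfl | rfl⟩ := G.exists_chord p
  · rw [chordOf_overPos, ← rotate_overPos, chordOf_overPos]
  · rw [chordOf_underPos, ← rotate_underPos, chordOf_underPos]

/-- Rotation commutes with taking the partner of a marked point. [folklore] -/
theorem partner_rotate (p : Fin (2 * G.n)) :
    (G.rotate k).partner (G.rotPos k p) = G.rotPos k (G.partner p) := by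
  obtain ⟨i, rfl | rfl⟩ := G.exists_chord p
  · rw [partner_overPos, ← rotate_overPos, partner_overPos, rotate_underPos]
  · rw [partner_underPos, ← rotate_underPos, partner_underPos, rotate_overPos]

/-- Rotation does not change the Seifert rule (signs are kept). [folklore] -/
theorem isSeifert_rotate (σ : G.State) (i : Fin G.n) :
    (G.rotate k).isSeifert σ i = G.isSeifert σ i := rfl

/-- The rotation of arcs is injective, as a map to the arcs of the rotated diagram (whose type of
arcs is definitionally that of `G`). [folklore] -/
theorem rotArc_apply_eq_iff (a b : G.Arc) :
    @Eq (G.rotate k).Arc (G.rotArc k a) (G.rotArc k b) ↔ a = b :=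
  (G.rotArc k).injective.eq_iff

/-- Rotation carries the reconnection relation of every state to that of the rotated diagram.
Viro (2004), §2 (the resolved 1-manifold does not depend on the base point). [cite: Viro2004, §2] -/
theorem stateAdj_rotate (σ : G.State) (a b : G.Arc) :
    (G.rotate k).stateAdj σ (G.rotArc k a) (G.rotArc k b) ↔ G.stateAdj σ a b := by
  unfold stateAdj
  refine and_congr (G.rotArc k).injective.ne_iff ⟨?_, ?_⟩
  · rintro ⟨p', hp'⟩
    obtain ⟨p, rfl⟩ := (G.rotPos k).surjective p'
    refine ⟨p, ?_⟩
    simpa only [chordOf_rotate, partner_rotate, ← rotArc_arcIn, ← rotArc_arcOut, isSeifert_rotate,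
      rotArc_apply_eq_iff] using hp'
  · rintro ⟨p, hp⟩
    refine ⟨G.rotPos k p, ?_⟩
    simpa only [chordOf_rotate, partner_rotate, ← rotArc_arcIn, ← rotArc_arcOut, isSeifert_rotate,
      rotArc_apply_eq_iff] using hp

/-- **Transfer data for a change of base point**: the identity on chords and the rotation of
arcs. GPV (2000), §1.2 (based versus unbased Gauss diagrams). [cite: GPV2000, §1.2] -/
def rotateTransfer : Transfer G (G.rotate k) where
  chord := _root_.Equiv.refl _
  arc := G.rotArc k
  sign_chord _ := rfl
  stateAdj_iff σ a b := G.stateAdj_rotate k σ a b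
  arcIn_overPos i := (G.rotArc_arcIn k (G.overPos i)).symm
  arcOut_overPos i := (G.rotArc_arcOut k (G.overPos i)).symm

/-- **Rasmussen's `s` of a based Gauss diagram does not depend on the base point**: rotating
the marked points (`GaussDiagram.rotate`, part of the bookkeeping move `PolyakMove.relabel`)
does not change `s`. The rotation of arcs induces an isomorphism of the cubes of resolutions
(same chords, same Koszul signs) preserving both gradings. Rasmussen (2010), Def. 3.4, Thm. 1;
GPV (2000), §1.2. [cite: Rasmussen2010, Thm. 1] -/
theorem rasmussenInvariant_rotate : (G.rotate k).rasmussenInvariant = G.rasmussenInvariant :=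
  (G.rotateTransfer k).rasmussenInvariant_eq (fun _ ↦ 1) (fun _ ↦ by norm_num) fun σ i _ ↦ by
    show ((edgeSign σ i : ℤ) : ℚ) = 1 * 1 * (edgeSign σ i : ℤ)
    ring

end Rotate

/-! ## Renumbering the chords: `s` of a relabelled Gauss diagram -/

section Relabel

variable (G : GaussDiagram) (π : _root_.Equiv.Perm (Fin G.n))

/-- Relabelling keeps the number of chords. [folklore] -/
theorem relabel_n : (G.relabel π).n = G.n := rfl

/-- Chord `j` of the relabelled diagram is chord `π j`: over-passages. [folklore] -/
theorem relabel_overPos (j : Fin G.n) : (G.relabel π).overPos j = G.overPos (π j) := rfl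

/-- Chord `j` of the relabelled diagram is chord `π j`: under-passages. [folklore] -/
theorem relabel_underPos (j : Fin G.n) : (G.relabel π).underPos j = G.underPos (π j) := rfl

/-- Chord `j` of the relabelled diagram is chord `π j`: signs. [folklore] -/
theorem relabel_sign (j : Fin G.n) : (G.relabel π).sign j = G.sign (π j) := rfl

/-- The chord of the relabelled diagram through a marked point. [folklore] -/
theorem chordOf_relabel (p : Fin (2 * G.n)) : (G.relabel π).chordOf p = π.symm (G.chordOf p) := by
  obtain ⟨i, rfl | rfl⟩ := G.exists_chord p
  · have h : G.overPos i = (G.relabel π).overPos (π.symm i) := by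
      rw [relabel_overPos, _root_.Equiv.apply_symm_apply]
    rw [G.chordOf_overPos i, h, chordOf_overPos]
  · have h : G.underPos i = (G.relabel π).underPos (π.symm i) := by
      rw [relabel_underPos, _root_.Equiv.apply_symm_apply]
    rw [G.chordOf_underPos i, h, chordOf_underPos]

/-- Relabelling the chords does not change partners of marked points. [folklore] -/
theorem partner_relabel (p : Fin (2 * G.n)) : (G.relabel π).partner p = G.partner p := by
  obtain ⟨i, rfl | rfl⟩ := G.exists_chord p
  · have h : G.overPos i = (G.relabel π).overPos (π.symm i) := by
      rw [relabel_overPos, _root_.Equiv.apply_symm_apply]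
    rw [G.partner_overPos i, h, partner_overPos, relabel_underPos, _root_.Equiv.apply_symm_apply]
  · have h : G.underPos i = (G.relabel π).underPos (π.symm i) := by
      rw [relabel_underPos, _root_.Equiv.apply_symm_apply]
    rw [G.partner_underPos i, h, partner_underPos, relabel_overPos, _root_.Equiv.apply_symm_apply]

/-- The Seifert rule of the relabelled diagram in the transported state. [folklore] -/
theorem isSeifert_relabel (σ : G.State) (j : Fin G.n) :
    (G.relabel π).isSeifert (σ ∘ π) j = G.isSeifert σ (π j) := rfl

/-- Relabelling the chords does not change the reconnection relation (in the transported
state). Viro (2004), §2. [cite: Viro2004, §2] -/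
theorem stateAdj_relabel (σ : G.State) (a b : G.Arc) :
    (G.relabel π).stateAdj (σ ∘ π) a b ↔ G.stateAdj σ a b := by
  unfold stateAdj
  refine and_congr Iff.rfl (exists_congr fun p ↦ ?_)
  rw [chordOf_relabel, isSeifert_relabel, _root_.Equiv.apply_symm_apply, partner_relabel]
  exact Iff.rfl

/-- **Transfer data for a renumbering of the chords**: the inverse renumbering on chords and
the identity on arcs. [folklore] -/
def relabelTransfer : Transfer G (G.relabel π) where
  chord := π.symm
  arc := _root_.Equiv.refl _
  sign_chord i := by
    show G.sign (π (π.symm i)) = G.sign i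
    rw [_root_.Equiv.apply_symm_apply]
  stateAdj_iff σ a b := G.stateAdj_relabel π σ a b
  arcIn_overPos i := by
    show (G.relabel π).arcIn (G.overPos (π (π.symm i))) = G.arcIn (G.overPos i)
    rw [_root_.Equiv.apply_symm_apply]
    rfl
  arcOut_overPos i := by
    show (G.relabel π).arcOut (G.overPos (π (π.symm i))) = G.arcOut (G.overPos i)
    rw [_root_.Equiv.apply_symm_apply]
    rfl

/-- Relabelling by the identity does nothing. [folklore] -/
theorem relabel_one : G.relabel 1 = G := by
  cases G; rfl

/-- Relabelling by a product is relabelling twice. [folklore] -/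
theorem relabel_mul (π₁ π₂ : _root_.Equiv.Perm (Fin G.n)) :
    G.relabel (π₁ * π₂) = (G.relabel π₁).relabel π₂ := rfl

variable {G}

/-- The Koszul sign as a product of `±1` over all chords. Khovanov (2000), §3.3. [cite: Khovanov2000, §3.3] -/
theorem edgeSign_eq_prod (σ : G.State) (i : Fin G.n) :
    edgeSign σ i = ∏ j, if j < i ∧ σ j = true then (-1 : ℤ) else 1 := by
  rw [edgeSign, Finset.prod_ite, Finset.prod_const_one, mul_one, Finset.prod_const]

/-- The **Koszul potential of an adjacent transposition** `(a b)`: `-1` on the states in which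
both chords `a` and `b` are `1`-smoothed, `+1` otherwise. Reordering two adjacent crossings
changes the Koszul sign of an edge of the cube exactly by the coboundary of this potential
(`edgeSign_swap`). Khovanov (2000), §3.3. [cite: Khovanov2000, §3.3] -/
def koszulSwap (a b : Fin G.n) (σ : G.State) : ℤ :=
  if σ a = true ∧ σ b = true then -1 else 1

/-- The Koszul potential is a sign: its square is `1`. [folklore] -/
theorem koszulSwap_mul_self (a b : Fin G.n) (σ : G.State) :
    koszulSwap a b σ * koszulSwap a b σ = 1 := by
  unfold koszulSwap; split_ifs <;> norm_num

/-- **Reordering two adjacent crossings changes the Koszul signs by a coboundary.** For the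
adjacent transposition `π = (a b)`, `b = a + 1`, and a `0`-smoothed chord `i` of `σ`:
`sgn(σ ∘ π, π i) = κ(σ) κ(σ[i ↦ 1]) sgn(σ, i)` with `κ = koszulSwap a b`.
Khovanov (2000), §3.3. [cite: Khovanov2000, §3.3] -/
theorem edgeSign_swap (a b : Fin G.n) (hab : (b : ℕ) = a + 1) (σ : G.State) (i : Fin G.n)
    (hi : σ i = false) :
    edgeSign (σ ∘ ⇑(_root_.Equiv.swap a b)) (_root_.Equiv.swap a b i) =
      koszulSwap a b σ * koszulSwap a b (Function.update σ i true) * edgeSign σ i := by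
  have hne : a ≠ b := fun h ↦ by rw [h] at hab; omega
  rw [edgeSign_eq_prod, edgeSign_eq_prod, ← _root_.Equiv.prod_comp (_root_.Equiv.swap a b)]
  simp only [comp_apply, _root_.Equiv.swap_apply_self]
  rcases eq_or_ne i a with hia | hia
  · -- `i = a`: the two sides differ at the factor `j = b` only
    subst hia
    rw [_root_.Equiv.swap_apply_left, ← Finset.mul_prod_erase _ _ (Finset.mem_univ b),
      ← Finset.mul_prod_erase _ _ (Finset.mem_univ b)]
    have hk : koszulSwap i b σ = 1 := by simp [koszulSwap, hi]
    have hk' : koszulSwap i b (Function.update σ i true) = if σ b = true then -1 else 1 := by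
      simp [koszulSwap, Function.update_of_ne hne.symm]
    have hcommon : ∏ j ∈ Finset.univ.erase b,
        (if _root_.Equiv.swap i b j < b ∧ σ j = true then (-1 : ℤ) else 1) =
        ∏ j ∈ Finset.univ.erase b, (if j < i ∧ σ j = true then (-1 : ℤ) else 1) := by
      refine Finset.prod_congr rfl fun j hj ↦ ?_
      have hjb : j ≠ b := (Finset.mem_erase.1 hj).1
      rcases eq_or_ne j i with rfl | hji
      · simp [hi]
      · rw [_root_.Equiv.swap_apply_of_ne_of_ne hji hjb]
        have : j < b ↔ j < i := by
          rw [Fin.lt_def, Fin.lt_def]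
          have := Fin.val_ne_of_ne hji
          omega
        simp only [this]
    rw [hcommon, hk, hk', _root_.Equiv.swap_apply_right]
    have hbb : ¬ b < i := by rw [Fin.lt_def]; omega
    have hib : i < b := by rw [Fin.lt_def]; omega
    simp [hbb, hib]
  rcases eq_or_ne i b with hib | hib
  · -- `i = b`: the two sides differ at the factor `j = a` only
    subst hib
    rw [_root_.Equiv.swap_apply_right, ← Finset.mul_prod_erase _ _ (Finset.mem_univ a),
      ← Finset.mul_prod_erase Finset.univ (fun j ↦ if j < i ∧ σ j = true then (-1 : ℤ) else 1)
        (Finset.mem_univ a)]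
    have hk : koszulSwap a i σ = 1 := by simp [koszulSwap, hi]
    have hk' : koszulSwap a i (Function.update σ i true) = if σ a = true then -1 else 1 := by
      simp [koszulSwap, Function.update_of_ne hne]
    have hcommon : ∏ j ∈ Finset.univ.erase a,
        (if _root_.Equiv.swap a i j < a ∧ σ j = true then (-1 : ℤ) else 1) =
        ∏ j ∈ Finset.univ.erase a, (if j < i ∧ σ j = true then (-1 : ℤ) else 1) := by
      refine Finset.prod_congr rfl fun j hj ↦ ?_
      have hja : j ≠ a := (Finset.mem_erase.1 hj).1
      rcases eq_or_ne j i with rfl | hji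
      · simp [hi]
      · rw [_root_.Equiv.swap_apply_of_ne_of_ne hja hji]
        have : j < a ↔ j < i := by
          rw [Fin.lt_def, Fin.lt_def]
          have := Fin.val_ne_of_ne hji
          have := Fin.val_ne_of_ne hja
          omega
        simp only [this]
    rw [hcommon, hk, hk', _root_.Equiv.swap_apply_left]
    have hai : a < i := by rw [Fin.lt_def]; omega
    have hia' : ¬ i < a := by rw [Fin.lt_def]; omega
    by_cases hσa : σ a = true
    · simp [hσa, hai, hia']
    · simp [hσa, hai, hia']
  · -- `i ∉ {a, b}`: the two products agree factorwise and the potential does not change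
    rw [_root_.Equiv.swap_apply_of_ne_of_ne hia hib]
    have hk : koszulSwap a b (Function.update σ i true) = koszulSwap a b σ := by
      simp [koszulSwap, Function.update_of_ne (Ne.symm hia), Function.update_of_ne (Ne.symm hib)]
    rw [hk, koszulSwap_mul_self, one_mul]
    refine Finset.prod_congr rfl fun j _ ↦ ?_
    rcases eq_or_ne j a with rfl | hja
    · rw [_root_.Equiv.swap_apply_left]
      have : b < i ↔ j < i := by
        rw [Fin.lt_def, Fin.lt_def]
        have := Fin.val_ne_of_ne hia
        have := Fin.val_ne_of_ne hib
        omega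
      simp only [this]
    rcases eq_or_ne j b with rfl | hjb
    · rw [_root_.Equiv.swap_apply_right]
      have : a < i ↔ j < i := by
        rw [Fin.lt_def, Fin.lt_def]
        have := Fin.val_ne_of_ne hia
        have := Fin.val_ne_of_ne hib
        omega
      simp only [this]
    rw [_root_.Equiv.swap_apply_of_ne_of_ne hja hjb]

variable (G)

/-- **Swapping the numbers of two adjacent chords does not change Rasmussen's `s`.** The
transfer along `(a b)` with the Koszul potential `koszulSwap a b` is a filtered isomorphism of
Lee complexes. Khovanov (2000), §3.3; Rasmussen (2010), Thm. 1. [cite: Khovanov2000, §3.3] -/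
theorem rasmussenInvariant_relabel_swap (a b : Fin G.n) (hab : (b : ℕ) = a + 1) :
    (G.relabel (_root_.Equiv.swap a b)).rasmussenInvariant = G.rasmussenInvariant :=
  (G.relabelTransfer (_root_.Equiv.swap a b)).rasmussenInvariant_eq
    (fun σ ↦ (koszulSwap a b σ : ℚ))
    (fun σ ↦ by exact_mod_cast koszulSwap_mul_self a b σ) fun σ i hi ↦ by
    show ((edgeSign (σ ∘ ⇑(_root_.Equiv.swap a b)) (_root_.Equiv.swap a b i) : ℤ) : ℚ) =
      (koszulSwap a b σ : ℚ) * (koszulSwap a b (Function.update σ i true) : ℚ) *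
        ((edgeSign σ i : ℤ) : ℚ)
    rw [edgeSign_swap a b hab σ i hi]
    push_cast
    ring

/-- **Rasmussen's `s` of a labelled Gauss diagram does not depend on the numbering of the
chords** (`GaussDiagram.relabel`, part of the bookkeeping move `PolyakMove.relabel`): the
symmetric group is generated by adjacent transpositions (`Equiv.Perm.mclosure_swap_castSucc_succ`)
and each of them acts by a filtered isomorphism of Lee complexes
(`rasmussenInvariant_relabel_swap`). Khovanov (2000), §3.3 (independence of the ordering of
the crossings); Rasmussen (2010), Thm. 1. [cite: Khovanov2000, §3.3] -/
theorem rasmussenInvariant_relabel : (G.relabel π).rasmussenInvariant = G.rasmussenInvariant := by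
  obtain ⟨n, o, u, sg, hb⟩ := G
  cases n with
  | zero =>
    have : π = 1 := Subsingleton.elim _ _
    subst this
    rw [relabel_one]
  | succ m =>
    have hπ : π ∈ Submonoid.closure
        (Set.range fun i : Fin m ↦ _root_.Equiv.swap i.castSucc i.succ) := by
      rw [_root_.Equiv.Perm.mclosure_swap_castSucc_succ m]; exact Submonoid.mem_top π
    suffices H : ∀ π ∈ Submonoid.closure
        (Set.range fun i : Fin m ↦ _root_.Equiv.swap i.castSucc i.succ),
        ∀ (o u : Fin (m + 1) → Fin (2 * (m + 1))) (sg : Fin (m + 1) → ℤˣ)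
          (hb : Bijective (Sum.elim o u)),
          (GaussDiagram.relabel ⟨m + 1, o, u, sg, hb⟩ π).rasmussenInvariant =
            GaussDiagram.rasmussenInvariant ⟨m + 1, o, u, sg, hb⟩ from H π hπ o u sg hb
    intro π hπ
    refine Submonoid.closure_induction (fun π' hπ' ↦ ?_) ?_ (fun π₁ π₂ _ _ h₁ h₂ ↦ ?_) hπ
    · obtain ⟨j, rfl⟩ := hπ'
      intro o u sg hb
      exact rasmussenInvariant_relabel_swap ⟨m + 1, o, u, sg, hb⟩ j.castSucc j.succ
        (by simp [Fin.val_succ])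
    · intro o u sg hb
      rw [relabel_one]
    · intro o u sg hb
      rw [relabel_mul]
      exact (h₂ (o ∘ ⇑π₁) (u ∘ ⇑π₁) (sg ∘ ⇑π₁)
        (GaussDiagram.relabel ⟨m + 1, o, u, sg, hb⟩ π₁).bijective).trans (h₁ o u sg hb)

/-- **Invariance of Rasmussen's `s` under the bookkeeping move** `PolyakMove.relabel`
(renumbering of the chords and change of base point, `GaussDiagram.IsRelabelling`), for all
Gauss diagrams (no realisability needed): the case `PolyakMove.relabel` of the named fact
`rasmussenInvariant_eq_of_equiv`. Rasmussen (2010), Thm. 1; GPV (2000), §1.2. [cite: Rasmussen2010, Thm. 1] -/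
theorem rasmussenInvariant_eq_of_isRelabelling {G G' : GaussDiagram} (h : G.IsRelabelling G') :
    G'.rasmussenInvariant = G.rasmussenInvariant := by
  obtain ⟨σ, k, rfl⟩ := h
  rw [rasmussenInvariant_rotate, rasmussenInvariant_relabel]

end Relabel

end GaussDiagram

end Literature.Topology.FourManifolds
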